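import Literature.Computability.Cryptography.WordRAMPatternTables
import HarnessLib

/-!
# The word RAM — the final trilinear sum of Pratt's evaluation and the answer flag

The last step of one repetition of Pratt's balanced-tripartitioning algorithm (K. Pratt, STOC 2024,
proof of Thm. 1.9; twelfth instalment of the proof of
`Literature.Computability.AlgebraicComplexity.pratt2024_thm_1_9`): after the three level tables
have been computed (`WordRAMContractLevels.dpProg`), the value of the restricted form is
`∑_{P < R^q} X_q[P] · Y_q[P] · Z_q[P]` (`KroneckerPowEvaluation.sum_contractLevel_mul_eq`), taken
in `w`-bit words, and the repetition succeeds iff it is non-zero: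

* `tripleSum m X Y Z SP = (∑_{P<SP} m (X+P) · m (Y+P) · m (Z+P)) mod 2^w` and its partial sums;
* `SProg.tripleProg` (inputs `45 = SP`, `46, 47, 48` = the three bases, `81` = the flag `found`;
  temporaries `82–88`) and **`tripleProg_spec`**: within `9 SP + 8` steps register `86` holds
  `tripleSum`, register `81` holds `orFlag found (tripleSum …)` (`1` if the old flag was set or
  the sum is non-zero, else `0`), memory otherwise unchanged outside `81–88`.

## References

* K. Pratt, *A stronger connection between the asymptotic rank conjecture and the set cover
  conjecture*, STOC 2024, arXiv:2311.02774, §2 (proof of Thm. 1.9).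
-/

namespace Literature.Computability.Cryptography.WordRAM

open StateTransition Finset

open scoped BigOperators

/-- The partial triple sums modulo `2^w`. [cite: Pratt2024SCC, §2 (proof of Thm. 1.9)] -/
def triplePart (w : ℕ) (m : ℕ → ℕ) (X Y Z p : ℕ) : ℕ :=
  (∑ P ∈ range p, m (X + P) * m (Y + P) * m (Z + P)) % 2 ^ w

/-- The full triple sum modulo `2^w`. [cite: Pratt2024SCC, §2 (proof of Thm. 1.9)] -/
def tripleSum (w : ℕ) (m : ℕ → ℕ) (X Y Z SP : ℕ) : ℕ := triplePart w m X Y Z SP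

/-- No terms. [folklore] -/
@[simp] theorem triplePart_zero (w : ℕ) (m : ℕ → ℕ) (X Y Z : ℕ) : triplePart w m X Y Z 0 = 0 := by
  simp [triplePart]

/-- One more term, in word arithmetic. [folklore] -/
theorem triplePart_succ (w : ℕ) (m : ℕ → ℕ) (X Y Z p : ℕ) :
    triplePart w m X Y Z (p + 1) =
      (triplePart w m X Y Z p + m (X + p) * m (Y + p) % 2 ^ w * m (Z + p) % 2 ^ w) % 2 ^ w := by
  unfold triplePart
  conv_rhs => rw [Nat.mod_mul_mod]
  rw [sum_range_succ, Nat.add_mod]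

/-- Partial sums are words. [folklore] -/
theorem triplePart_lt (w : ℕ) (m : ℕ → ℕ) (X Y Z p : ℕ) : triplePart w m X Y Z p < 2 ^ w :=
  Nat.mod_lt _ (Nat.two_pow_pos w)

/-- The new flag: `1` if the old flag is set or the value is non-zero. [folklore] -/
def orFlag (found v : ℕ) : ℕ := if 0 < found + (if 0 < v then 1 else 0) then 1 else 0

namespace SProg

variable {w : ℕ} {O : List ℕ → List ℕ}

/-- Set-up: `cnt := SP; px := X; py := Y; pz := Z; acc := 0`. [folklore] -/
def tripleSetup : List OpSpec :=
  [(.add, .dir 82, .dir 45, .imm 0), (.add, .dir 83, .dir 46, .imm 0), (.add, .dir 84, .dir 47, .imm 0),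
    (.add, .dir 85, .dir 48, .imm 0), (.add, .dir 86, .imm 0, .imm 0)]

/-- Body: `t := mem[px]; t := t * mem[py]; t := t * mem[pz]; acc := acc + t; px++; py++; pz++; cnt--`.
[cite: Pratt2024SCC, §2 (proof of Thm. 1.9)] -/
def tripleBody : List OpSpec :=
  [(.add, .dir 87, .ind 83, .imm 0), (.mul, .dir 87, .dir 87, .ind 84), (.mul, .dir 87, .dir 87, .ind 85),
    (.add, .dir 86, .dir 86, .dir 87), (.add, .dir 83, .dir 83, .imm 1), (.add, .dir 84, .dir 84, .imm 1),
    (.add, .dir 85, .dir 85, .imm 1), (.sub, .dir 82, .dir 82, .imm 1)]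

/-- Finish: `flag := (0 < acc); t := found + flag; found := (0 < t)`. [folklore] -/
def tripleFinish : List OpSpec :=
  [(.lt, .dir 88, .imm 0, .dir 86), (.add, .dir 87, .dir 81, .dir 88), (.lt, .dir 81, .imm 0, .dir 87)]

/-- **The triple-sum program.** [cite: Pratt2024SCC, §2 (proof of Thm. 1.9)] -/
def tripleProg : SProg :=
  seq (block tripleSetup) (seq (whilenz (.dir 82) (block tripleBody)) (block tripleFinish))

/-- Invariant of the sum loop after `p` terms. [folklore] -/
structure TripleInv (m : ℕ → ℕ) (X Y Z SP : ℕ) (qs : List (List ℕ)) (p : ℕ) (st : Store) : Prop where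
  queries : st.queries = qs
  r82 : st.mem 82 = SP - p
  r83 : st.mem 83 = X + p
  r84 : st.mem 84 = Y + p
  r85 : st.mem 85 = Z + p
  r86 : st.mem 86 = triplePart w m X Y Z p
  frame : ∀ c, ¬ (82 ≤ c ∧ c ≤ 88) → st.mem c = m c

set_option linter.unusedSimpArgs false in
/-- One term. [folklore] -/
theorem tripleBody_spec {m : ℕ → ℕ} {X Y Z SP : ℕ} {qs : List (List ℕ)} {p : ℕ} (hp : p < SP)
    (hX : 100 ≤ X) (hY : 100 ≤ Y) (hZ : 100 ≤ Z) (hXE : X + SP < 2 ^ w) (hYE : Y + SP < 2 ^ w)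
    (hZE : Z + SP < 2 ^ w) (hval : ∀ P, P < SP → m (X + P) < 2 ^ w)
    {st : Store} (h : TripleInv (w := w) m X Y Z SP qs p st) :
    ∃ st', Exec w O (block tripleBody) st st' 8 ∧ TripleInv (w := w) m X Y Z SP qs (p + 1) st' := by
  obtain ⟨hq, h82, h83, h84, h85, h86, hfr⟩ := h
  obtain ⟨mm, qq⟩ := st
  simp only at hq h82 h83 h84 h85 h86 hfr
  subst qq
  have hx : mm (X + p) = m (X + p) := hfr _ (by omega)
  have hy : mm (Y + p) = m (Y + p) := hfr _ (by omega)
  have hz : mm (Z + p) = m (Z + p) := hfr _ (by omega)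
  have hxv : m (X + p) < 2 ^ w := hval p hp
  have hacc : triplePart w m X Y Z p < 2 ^ w := triplePart_lt _ _ _ _ _ _
  refine Exec.block_of_fwd tripleBody qs fun Rf hR => ?_
  unfold tripleBody at hR
  have htmp := execOps_cons_fwd hR; clear hR; obtain ⟨v1, hv1, hR⟩ := htmp
  simp -failIfUnchanged (disch := omega) only [Operand.write, Operand.read,
    Function.update_self, Function.update_of_ne, BinOp.eval_add_mod', BinOp.eval_mul_mod',
    Nat.mod_eq_of_lt, BinOp.eval_sub_of_le, BinOp.eval_lt, Nat.add_zero, h83, hx] at hv1 hR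
  subst v1
  have htmp := execOps_cons_fwd hR; clear hR; obtain ⟨v2, hv2, hR⟩ := htmp
  simp -failIfUnchanged (disch := omega) only [Operand.write, Operand.read,
    Function.update_self, Function.update_of_ne, BinOp.eval_add_mod', BinOp.eval_mul_mod',
    Nat.mod_eq_of_lt, BinOp.eval_sub_of_le, BinOp.eval_lt, Nat.add_zero, h84, hy] at hv2 hR
  subst v2
  have htmp := execOps_cons_fwd hR; clear hR; obtain ⟨v3, hv3, hR⟩ := htmp
  simp -failIfUnchanged (disch := omega) only [Operand.write, Operand.read,
    Function.update_self, Function.update_of_ne, BinOp.eval_add_mod', BinOp.eval_mul_mod',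
    Nat.mod_eq_of_lt, BinOp.eval_sub_of_le, BinOp.eval_lt, Nat.add_zero, h85, hz] at hv3 hR
  subst v3
  have htmp := execOps_cons_fwd hR; clear hR; obtain ⟨v4, hv4, hR⟩ := htmp
  simp -failIfUnchanged (disch := omega) only [Operand.write, Operand.read,
    Function.update_self, Function.update_of_ne, BinOp.eval_add_mod', BinOp.eval_mul_mod',
    Nat.mod_eq_of_lt, BinOp.eval_sub_of_le, BinOp.eval_lt, Nat.add_zero, h86] at hv4 hR
  subst v4
  have htmp := execOps_cons_fwd hR; clear hR; obtain ⟨v5, hv5, hR⟩ := htmp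
  simp -failIfUnchanged (disch := omega) only [Operand.write, Operand.read,
    Function.update_self, Function.update_of_ne, BinOp.eval_add_mod', BinOp.eval_mul_mod',
    Nat.mod_eq_of_lt, BinOp.eval_sub_of_le, BinOp.eval_lt, Nat.add_zero, h83] at hv5 hR
  subst v5
  have htmp := execOps_cons_fwd hR; clear hR; obtain ⟨v6, hv6, hR⟩ := htmp
  simp -failIfUnchanged (disch := omega) only [Operand.write, Operand.read,
    Function.update_self, Function.update_of_ne, BinOp.eval_add_mod', BinOp.eval_mul_mod',
    Nat.mod_eq_of_lt, BinOp.eval_sub_of_le, BinOp.eval_lt, Nat.add_zero, h84] at hv6 hR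
  subst v6
  have htmp := execOps_cons_fwd hR; clear hR; obtain ⟨v7, hv7, hR⟩ := htmp
  simp -failIfUnchanged (disch := omega) only [Operand.write, Operand.read,
    Function.update_self, Function.update_of_ne, BinOp.eval_add_mod', BinOp.eval_mul_mod',
    Nat.mod_eq_of_lt, BinOp.eval_sub_of_le, BinOp.eval_lt, Nat.add_zero, h85] at hv7 hR
  subst v7
  have htmp := execOps_cons_fwd hR; clear hR; obtain ⟨v8, hv8, hR⟩ := htmp
  simp -failIfUnchanged (disch := omega) only [Operand.write, Operand.read,
    Function.update_self, Function.update_of_ne, BinOp.eval_add_mod', BinOp.eval_mul_mod',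
    Nat.mod_eq_of_lt, BinOp.eval_sub_of_le, BinOp.eval_lt, Nat.add_zero, h82] at hv8 hR
  subst v8
  simp only [execOps_nil] at hR
  subst hR
  refine ⟨rfl, ?_, ?_, ?_, ?_, ?_, fun c hc => ?_⟩ <;> dsimp only
  · simp (disch := omega) only [Function.update_of_ne, Function.update_self]; omega
  · simp (disch := omega) only [Function.update_of_ne, Function.update_self]; omega
  · simp (disch := omega) only [Function.update_of_ne, Function.update_self]; omega
  · simp (disch := omega) only [Function.update_of_ne, Function.update_self]; omega
  · simp (disch := omega) only [Function.update_of_ne, Function.update_self]; rw [triplePart_succ]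
  · simp (disch := omega) only [Function.update_of_ne, Function.update_self]; exact hfr c hc

set_option linter.unusedSimpArgs false in
/-- **The triple sum and the flag.** With `SP` in `45`, the three bases (data addresses, tables inside
the address space, entries of the first table words) in `46–48` and the flag `found ≤ 1` in `81`,
`tripleProg` ends within `10 SP + 9` steps with `86 = tripleSum`, `81 = orFlag found tripleSum`,
and every cell outside `81–88` unchanged. [cite: Pratt2024SCC, §2 (proof of Thm. 1.9)] -/
theorem tripleProg_spec {m : ℕ → ℕ} {X Y Z SP found : ℕ} (h45 : m 45 = SP) (h46 : m 46 = X)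
    (h47 : m 47 = Y) (h48 : m 48 = Z) (h81 : m 81 = found) (hfound : found ≤ 1)
    (hX : 100 ≤ X) (hY : 100 ≤ Y) (hZ : 100 ≤ Z) (hXE : X + SP < 2 ^ w) (hYE : Y + SP < 2 ^ w)
    (hZE : Z + SP < 2 ^ w) (hSP : SP < 2 ^ w) (hw : 2 ≤ w) (hval : ∀ P, P < SP → m (X + P) < 2 ^ w)
    (qs : List (List ℕ)) :
    ∃ st', ExecLE w O tripleProg ⟨m, qs⟩ st' (SP * 10 + 9) ∧ st'.queries = qs ∧
      st'.mem 86 = tripleSum w m X Y Z SP ∧ st'.mem 81 = orFlag found (tripleSum w m X Y Z SP) ∧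
      (∀ c, ¬ (81 ≤ c ∧ c ≤ 88) → st'.mem c = m c) := by
  have hw4 : 4 ≤ 2 ^ w := by
    calc (4 : ℕ) = 2 ^ 2 := by norm_num
      _ ≤ 2 ^ w := Nat.pow_le_pow_right (by norm_num) hw
  obtain ⟨st₁, hex₁, hI⟩ : ∃ st', Exec w O (block tripleSetup) ⟨m, qs⟩ st' 5 ∧
      TripleInv (w := w) m X Y Z SP qs 0 st' := by
    refine Exec.block_of_fwd tripleSetup qs fun Rf hR => ?_
    unfold tripleSetup at hR
    have htmp := execOps_cons_fwd hR; clear hR; obtain ⟨v1, hv1, hR⟩ := htmp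
    simp -failIfUnchanged (disch := omega) only [Operand.write, Operand.read,
      Function.update_self, Function.update_of_ne, BinOp.eval_add_mod', BinOp.eval_mul_mod',
      Nat.mod_eq_of_lt, BinOp.eval_sub_of_le, BinOp.eval_lt, Nat.add_zero, h45] at hv1 hR
    subst v1
    have htmp := execOps_cons_fwd hR; clear hR; obtain ⟨v2, hv2, hR⟩ := htmp
    simp -failIfUnchanged (disch := omega) only [Operand.write, Operand.read,
      Function.update_self, Function.update_of_ne, BinOp.eval_add_mod', BinOp.eval_mul_mod',
      Nat.mod_eq_of_lt, BinOp.eval_sub_of_le, BinOp.eval_lt, Nat.add_zero, h46] at hv2 hR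
    subst v2
    have htmp := execOps_cons_fwd hR; clear hR; obtain ⟨v3, hv3, hR⟩ := htmp
    simp -failIfUnchanged (disch := omega) only [Operand.write, Operand.read,
      Function.update_self, Function.update_of_ne, BinOp.eval_add_mod', BinOp.eval_mul_mod',
      Nat.mod_eq_of_lt, BinOp.eval_sub_of_le, BinOp.eval_lt, Nat.add_zero, h47] at hv3 hR
    subst v3
    have htmp := execOps_cons_fwd hR; clear hR; obtain ⟨v4, hv4, hR⟩ := htmp
    simp -failIfUnchanged (disch := omega) only [Operand.write, Operand.read,
      Function.update_self, Function.update_of_ne, BinOp.eval_add_mod', BinOp.eval_mul_mod',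
      Nat.mod_eq_of_lt, BinOp.eval_sub_of_le, BinOp.eval_lt, Nat.add_zero, h48] at hv4 hR
    subst v4
    have htmp := execOps_cons_fwd hR; clear hR; obtain ⟨v5, hv5, hR⟩ := htmp
    simp -failIfUnchanged (disch := omega) only [Operand.write, Operand.read,
      Function.update_self, Function.update_of_ne, BinOp.eval_add_mod', BinOp.eval_mul_mod',
      Nat.mod_eq_of_lt, BinOp.eval_sub_of_le, BinOp.eval_lt, Nat.add_zero] at hv5 hR
    subst v5
    simp only [execOps_nil] at hR
    subst hR
    refine ⟨rfl, ?_, ?_, ?_, ?_, ?_, fun c hc => ?_⟩ <;> dsimp only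
    · simp (disch := omega) only [Function.update_of_ne, Function.update_self]; omega
    · simp (disch := omega) only [Function.update_of_ne, Function.update_self]; omega
    · simp (disch := omega) only [Function.update_of_ne, Function.update_self]; omega
    · simp (disch := omega) only [Function.update_of_ne, Function.update_self]; omega
    · simp (disch := omega) only [Function.update_of_ne, Function.update_self]; simp
    · simp (disch := omega) only [Function.update_of_ne, Function.update_self]
  obtain ⟨st₂, hex₂, hI₂⟩ := ExecLE.whilenz_invariant (w := w) (O := O) (x := .dir 82)
    (s := block tripleBody) SP 8 (fun p st => TripleInv (w := w) m X Y Z SP qs p st)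
    (fun p hp st hst => ⟨by rw [Operand.read_dir, hst.r82]; omega,
      by obtain ⟨st', hex, hinv⟩ := tripleBody_spec (w := w) (O := O) hp hX hY hZ hXE hYE hZE hval hst
         exact ⟨st', hex.execLE, hinv⟩⟩)
    (fun st hst => by rw [Operand.read_dir, hst.r82]; omega) hI
  -- the finish block
  obtain ⟨hq₂, g82, g83, g84, g85, g86, gfr⟩ := hI₂
  obtain ⟨mm, qq⟩ := st₂
  simp only at hq₂ g82 g83 g84 g85 g86 gfr
  subst qq
  have g81 : mm 81 = found := by rw [gfr 81 (by omega)]; exact h81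
  have hacc : triplePart w m X Y Z SP < 2 ^ w := triplePart_lt _ _ _ _ _ _
  obtain ⟨st₃, hex₃, hP⟩ : ∃ st', Exec w O (block tripleFinish) ⟨mm, qs⟩ st' 3 ∧
      (st'.queries = qs ∧ st'.mem 86 = tripleSum w m X Y Z SP ∧
        st'.mem 81 = orFlag found (tripleSum w m X Y Z SP) ∧ ∀ c, ¬ (81 ≤ c ∧ c ≤ 88) → st'.mem c = m c) := by
    refine Exec.block_of_fwd tripleFinish qs fun Rf hR => ?_
    unfold tripleFinish at hR
    have hlt1 : (if 0 < triplePart w m X Y Z SP then 1 else 0) ≤ 1 := by split_ifs <;> omega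
    have htmp := execOps_cons_fwd hR; clear hR; obtain ⟨v1, hv1, hR⟩ := htmp
    simp -failIfUnchanged (disch := omega) only [Operand.write, Operand.read,
      Function.update_self, Function.update_of_ne, BinOp.eval_add_mod', BinOp.eval_mul_mod',
      Nat.mod_eq_of_lt, BinOp.eval_sub_of_le, BinOp.eval_lt, Nat.add_zero, g86] at hv1 hR
    subst v1
    have htmp := execOps_cons_fwd hR; clear hR; obtain ⟨v2, hv2, hR⟩ := htmp
    simp -failIfUnchanged (disch := omega) only [Operand.write, Operand.read,
      Function.update_self, Function.update_of_ne, BinOp.eval_add_mod', BinOp.eval_mul_mod',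
      Nat.mod_eq_of_lt, BinOp.eval_sub_of_le, BinOp.eval_lt, Nat.add_zero, g81] at hv2 hR
    subst v2
    have htmp := execOps_cons_fwd hR; clear hR; obtain ⟨v3, hv3, hR⟩ := htmp
    simp -failIfUnchanged (disch := omega) only [Operand.write, Operand.read,
      Function.update_self, Function.update_of_ne, BinOp.eval_add_mod', BinOp.eval_mul_mod',
      Nat.mod_eq_of_lt, BinOp.eval_sub_of_le, BinOp.eval_lt, Nat.add_zero] at hv3 hR
    subst v3
    simp only [execOps_nil] at hR
    subst hR
    refine ⟨rfl, ?_, ?_, fun c hc => ?_⟩ <;> dsimp only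
    · simp (disch := omega) only [Function.update_of_ne, Function.update_self]; exact g86
    · simp (disch := omega) only [Function.update_of_ne, Function.update_self]; rfl
    · simp (disch := omega) only [Function.update_of_ne, Function.update_self]
      exact gfr c (fun hh => hc ⟨by omega, hh.2⟩)
  exact ⟨st₃, ((hex₁.execLE).seq (hex₂.seq hex₃.execLE)).mono (by omega), hP⟩

end SProg

end Literature.Computability.Cryptography.WordRAM
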